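import Literature.MathematicalPhysics.QuantumFieldTheory.Balaban1983to89.B6Jacobian2155Torus
import Literature.MathematicalPhysics.QuantumFieldTheory.Balaban1983to89.B6Ineq2118TwoScaleV1
import HarnessLib

/-!
# `AlphaInputsT3ACFlatLoewnerLetters` — THE FLAT (`U = 1`) LOEWNER LETTERS OF (α) ROWS #12 `norm35` ∕ #13 `logZT` IN MATRIX CURRENCY: for the unit-torus form
# `Δ_k` of [Balaban1984PropagatorsI] (1.66) (`B6Cov2156Torus.deltaPol M n`) and the constraint elimination `C` of [Balaban1984PropagatorsII] (2.154) (`B6Cov2156Torus.elimT L M`),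
# **`γ′₀·1 ⪯ CᵀΔ_kC ⪯ a·1`** with `γ′₀ = gamma2153 d L` ([B6] (2.157)) and `a = 16·d·L^d·(π²∕4)^{2d+4}` EXPLICIT — unconditionally (`d ≥ 2`, `L ≥ 1`, `n ≥ 1`, `L ∣ M_i`),
# uniform in the level `n = L^k` and in the torus sides `M` — transported along any reindexing `freeT L M ≃ Fin m` and tripled over the colour index `Fin 3`

Cell `ym3-torus` (HUMAN RULING D-0037, YM ladder rung R3), width seat `ym-ust-19936-w8` (g15); ★★OWNER ym3-torus-plan g35 GO 2026-08-30T12:07:08Z after the LOCATE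
`LOCATE-FLAT-COERCIVITY-norm35-logZT-w8g15.md` (19936 evidence #56).  `--supports stmt-QuantumFields-19936` (helper).  THEOREMS ONLY (def-free), sorry-free, standard axioms.
CREDIT NOTHING: (α) data rows 0∕23 before and after; a located carrier is not a supplied row.

WHY.  Rows #12∕#13 of the registered (O‴χₛ) stub `stub_selXsV4DataRows` (crux `HistoryTailL`) are, as typed, the scalar leaves (35)_k ∕ (65)_T
(✓`AlphaInputsT3ACNorm35LogZTRowsOfLeaves`, p771090); in their INTENDED reading (`….logZTExtensiveAsCited_piecesAC_of_loewner (hlo) (hhi) (hcount) (hjac)`) the B0 DEFINER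
of Bałaban's expansion data must hand over Loewner bounds `(QT − c•1).PosSemidef`, `(a•1 − QT).PosSemidef` for the precision form `QT` of the FLAT constrained Gaussian
`Z^{(k)}(T₁^{(k)}, 1)` ([Balaban1985UV3] (62) p.271, p.272 L1–2; [Balaban1985BackgroundPropagators] (3.155)–(3.158) p.427–428: the form `⟨B, Δ_kB⟩` on
`{B = 0 on Λᶜ, B = 0 on ⋃Ax(y), Q₁B = 0}` parametrised by `B = CB̃`, with «a positive definite operator C*Δ_kC with a lower bound γ₀ > 0 independent of k and U. We have proved
it in [4], Lemma 2.4, for operators with U = 1»; [4] = [Balaban1984PropagatorsII]).  That flat theorem IS in the tree in matrix currency: ✓`B6Jacobian2155Torus.sandwich_lower`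
∕ `sandwich_posDef_deltaPol` over ✓`B6Lemma24Torus.lemma24_torus` ((2.128)) and ✓`B5Bounds167Lattice.ineq167` ((1.67)).  THIS FILE packages it in EXACTLY the `PosSemidef`
letters the door p771090 takes, adds the (easy) UPPER bound ((1.67) upper + the landed curl bound + a Schur test), and transports both along the reindexing∕colour-tripling a definer will use
(`QT := Matrix.reindex e e (Matrix.blockDiagonal fun _ : Fin 3 => (elimT L M)ᵀ * deltaPol M n * elimT L M)`).

WHAT IS PROVED (kernel; [folklore] linear algebra + the cited carriers BY NAME).
* §0 folklore (`private`, v1.1 — the short names exist elsewhere in the tree for other summits; nothing is exported from §0): `posSemidef_sub_smul_one_of_le_form` ∕ `posSemidef_smul_one_sub_of_form_le` (Rayleigh ⇒ Loewner, real symmetric matrices); `posSemidef_reindex`;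
  `posSemidef_blockDiagonal`; `reindex_sub_smul_one` ∕ `reindex_smul_one_sub` ∕ `blockDiagonal_const_sub_smul_one` ∕ `blockDiagonal_smul_one_sub_const` (the letters commute
  with the transports).
* §1 (L1) ★`sandwich_sub_smul_one_posSemidef` — `((elimT L M)ᵀ * Δ * elimT L M − γ•1).PosSemidef` for every symmetric `Δ` with (2.153)_T-constant `γ ≥ 0`;
  ★★`sandwich_deltaPol_sub_smul_one_posSemidef` — `((elimT L M)ᵀ * deltaPol M n * elimT L M − gamma2153 d L • 1).PosSemidef` UNCONDITIONALLY.
* §2 (L2) ★`form_deltaPol_le` — `⟨B, Δ_kB⟩ ≤ 8d(π²∕4)^{2d+4}·‖B‖²` ((1.67) upper ✓`B5Bounds167Lattice.ineq167` ∘ the curl bound `⟨∂₁B,∂₁B⟩ ≤ 8d·‖B‖²` ✓`B6Ineq2118TwoScaleV1.d1Sq_le`,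
  both BY NAME); ★`sum_sq_elimT_mulVec_le` — `‖CB̃‖² ≤ 2L^d‖B̃‖²` (Schur test from ✓`elimT_col ≤ 2`, ✓`elimT_row ≤ L^d`);
  ★★`smul_one_sub_sandwich_deltaPol_posSemidef` — `(16dL^d(π²∕4)^{2d+4} • 1 − (elimT L M)ᵀ * deltaPol M n * elimT L M).PosSemidef`.
* §3 (L3) ★★★`loewner_letters_reindex_blockDiagonal` — for every `e : ↥(freeT L M) × Fin 3 ≃ Fin m`: with `Q := reindex e e (blockDiagonal fun _ => (elimT L M)ᵀ * deltaPol M n * elimT L M)`,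
  `(Q − gamma2153 d L • 1).PosSemidef ∧ (16dL^d(π²∕4)^{2d+4} • 1 − Q).PosSemidef` — the `hlo`∕`hhi` letters of p771090's `logZTExtensiveAsCited_piecesAC_of_loewner` VERBATIM in
  shape (`((𝔖 k).QT − c • 1).PosSemidef` ∕ `(a • 1 − (𝔖 k).QT).PosSemidef` on `Fin (𝔖 k).dimT`) the day B0 sets `(𝔖 k).dimT := m`, `(𝔖 k).QT := Q`.
UNIFORMITY: `gamma2153 d L = (4∕π²)^{d+2}∕(12d²)·L^{−(d+1)}` and `a` depend on `d, L` only — every level `n ≥ 1`, every torus with `L ∣ M_i` ([B9] p.428 «independent of k»;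
[B10] p.272 L1 «γ₁ is an upper bound of the positive, bounded operator C*Δ_kC»).
HONEST SCOPE.  Linear-algebra packaging of LANDED Literature theorems; the identification of a future witness's `QT` with `Q` is the B0 DEFINER's (not made here); nothing of
[Balaban1985UV3] is proved; rows #12∕#13, (O‴χₛ), EX, `HistoryTailL` (19936), 19200, 20520, `YM3TorusSU2` NOT proved; rung R3 = SU(2) YM₃ on T³ — NOT d = 4, NOT infinite volume,
NOT a mass gap, NOT Clay.
References: T. Bałaban, CMP 96 (1984) 223–250 [Balaban1984PropagatorsII] (Lemma 2.4 (2.128) p.245, (2.153)–(2.157) pp.249–250); CMP 95 (1984) 17–40 [Balaban1984PropagatorsI]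
((1.66)–(1.67) p.29); CMP 99 (1985) 389–434 [Balaban1985BackgroundPropagators] ((3.155)–(3.158) pp.427–428); CMP 102 (1985) 255–275 [Balaban1985UV3] ((62) p.271, p.272 L1–2).
-/

set_option autoImplicit false

noncomputable section

open Finset Matrix

namespace Summit.QuantumFields.YangMills.Theorems.AlphaInputsT3ACFlatLoewnerLetters

open Literature.MathematicalPhysics.QuantumFieldTheory.Balaban1983to89
open Literature.MathematicalPhysics.QuantumFieldTheory.Balaban1983to89.B5Prop11Plancherel (Tor)
open Literature.MathematicalPhysics.QuantumFieldTheory.Balaban1983to89.B5Bounds167Lattice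
  (d1Sq formDk ofRealCfg ineq167)
open Literature.MathematicalPhysics.QuantumFieldTheory.Balaban1983to89.B6Lemma24Torus (pbox)
open Literature.MathematicalPhysics.QuantumFieldTheory.Balaban1983to89.B6Cov2156Torus
  (ofBox sum_box_eq freeT elimT elimT_col elimT_row deltaPol deltaPol_isSymm represents_deltaPol LowerOnConstrainedT gamma2153 gamma2153_pos
   lowerOnConstrainedT_of_represents)
open Literature.MathematicalPhysics.QuantumFieldTheory.Balaban1983to89.B6Jacobian2155Torus (quad_sandwich sandwich_lower)

/-! ## §0 Folklore: Rayleigh ⇒ Loewner; transports -/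

section Folklore

/-- Rayleigh lower bound ⇒ Loewner letter: `c‖w‖² ≤ ⟨w, Sw⟩` for all `w` and `S` symmetric ⇒ `(S − c•1) ⪰ 0`. [folklore] -/
private theorem posSemidef_sub_smul_one_of_le_form {ι : Type} [Fintype ι] [DecidableEq ι] {S : Matrix ι ι ℝ} (hS : S.IsSymm) {c : ℝ} (h : ∀ w : ι → ℝ, c * ∑ i, w i ^ 2 ≤ w ⬝ᵥ (S *ᵥ w)) :
    (S - c • (1 : Matrix ι ι ℝ)).PosSemidef := by
  refine PosSemidef.of_dotProduct_mulVec_nonneg ?_ fun w => ?_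
  · have h1 : (S - c • (1 : Matrix ι ι ℝ)).IsSymm := by
      unfold Matrix.IsSymm at *
      rw [transpose_sub, hS, transpose_smul, transpose_one]
    rw [Matrix.IsHermitian, conjTranspose, h1]
    rfl
  · have hw := h w
    have e : star w ⬝ᵥ ((S - c • (1 : Matrix ι ι ℝ)) *ᵥ w) = w ⬝ᵥ (S *ᵥ w) - c * ∑ i, w i ^ 2 := by
      rw [star_trivial, sub_mulVec, dotProduct_sub, Matrix.smul_mulVec, one_mulVec, dotProduct_smul, smul_eq_mul]
      congr 2
      simp only [dotProduct, sq]
    rw [e]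
    linarith

/-- Rayleigh upper bound ⇒ Loewner letter: `⟨w, Sw⟩ ≤ a‖w‖²` for all `w` and `S` symmetric ⇒ `(a•1 − S) ⪰ 0`. [folklore] -/
private theorem posSemidef_smul_one_sub_of_form_le {ι : Type} [Fintype ι] [DecidableEq ι] {S : Matrix ι ι ℝ} (hS : S.IsSymm) {a : ℝ} (h : ∀ w : ι → ℝ, w ⬝ᵥ (S *ᵥ w) ≤ a * ∑ i, w i ^ 2) :
    (a • (1 : Matrix ι ι ℝ) - S).PosSemidef := by
  refine PosSemidef.of_dotProduct_mulVec_nonneg ?_ fun w => ?_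
  · have h1 : (a • (1 : Matrix ι ι ℝ) - S).IsSymm := by
      unfold Matrix.IsSymm at *
      rw [transpose_sub, hS, transpose_smul, transpose_one]
    rw [Matrix.IsHermitian, conjTranspose, h1]
    rfl
  · have hw := h w
    have e : star w ⬝ᵥ ((a • (1 : Matrix ι ι ℝ) - S) *ᵥ w) = a * ∑ i, w i ^ 2 - w ⬝ᵥ (S *ᵥ w) := by
      rw [star_trivial, sub_mulVec, dotProduct_sub, Matrix.smul_mulVec, one_mulVec, dotProduct_smul, smul_eq_mul]
      congr 2
      simp only [dotProduct, sq]
    rw [e]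
    linarith

/-- `reindex e e (S − c•1) = reindex e e S − c•1`. [folklore] -/
private theorem reindex_sub_smul_one {ι κ : Type} [DecidableEq ι] [DecidableEq κ] (e : ι ≃ κ) (S : Matrix ι ι ℝ) (c : ℝ) :
    Matrix.reindex e e (S - c • (1 : Matrix ι ι ℝ)) = Matrix.reindex e e S - c • (1 : Matrix κ κ ℝ) := by
  ext i j
  simp only [Matrix.reindex_apply, Matrix.submatrix_apply, Matrix.sub_apply, Matrix.smul_apply, Matrix.one_apply,
    EmbeddingLike.apply_eq_iff_eq]

/-- `reindex e e (a•1 − S) = a•1 − reindex e e S`. [folklore] -/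
private theorem reindex_smul_one_sub {ι κ : Type} [DecidableEq ι] [DecidableEq κ] (e : ι ≃ κ) (S : Matrix ι ι ℝ) (a : ℝ) :
    Matrix.reindex e e (a • (1 : Matrix ι ι ℝ) - S) = a • (1 : Matrix κ κ ℝ) - Matrix.reindex e e S := by
  ext i j
  simp only [Matrix.reindex_apply, Matrix.submatrix_apply, Matrix.sub_apply, Matrix.smul_apply, Matrix.one_apply,
    EmbeddingLike.apply_eq_iff_eq]

/-- Reindexing along an equivalence preserves `PosSemidef`. [folklore] -/
private theorem posSemidef_reindex {ι κ : Type} (e : ι ≃ κ) {S : Matrix ι ι ℝ} (hS : S.PosSemidef) : (Matrix.reindex e e S).PosSemidef := by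
  rw [Matrix.reindex_apply]
  exact hS.submatrix e.symm

/-- A block-diagonal matrix with positive semidefinite blocks is positive semidefinite. [folklore] -/
private theorem posSemidef_blockDiagonal {ι o : Type} [Fintype ι] [Fintype o] [DecidableEq o] {N : o → Matrix ι ι ℝ} (h : ∀ k, (N k).PosSemidef) : (blockDiagonal N).PosSemidef := by
  refine PosSemidef.of_dotProduct_mulVec_nonneg ?_ fun x => ?_
  · rw [Matrix.IsHermitian, blockDiagonal_conjTranspose]
    congr 1
    funext k
    exact (h k).1
  · have e : star x ⬝ᵥ (blockDiagonal N *ᵥ x) = ∑ k, (fun i => x (i, k)) ⬝ᵥ (N k *ᵥ fun i => x (i, k)) := by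
      simp only [star_trivial, dotProduct, mulVec, blockDiagonal_apply', Fintype.sum_prod_type, ite_mul, zero_mul,
        Finset.sum_ite_eq, Finset.mem_univ, if_true]
      exact Finset.sum_comm
    rw [e]
    exact Finset.sum_nonneg fun k _ => by simpa only [star_trivial] using (h k).dotProduct_mulVec_nonneg fun i => x (i, k)

/-- `blockDiagonal (fun _ => S) − c•1 = blockDiagonal (fun _ => S − c•1)`. [folklore] -/
private theorem blockDiagonal_const_sub_smul_one {ι o : Type} [DecidableEq ι] [DecidableEq o] (S : Matrix ι ι ℝ) (c : ℝ) :
    blockDiagonal (fun _ : o => S) - c • (1 : Matrix (ι × o) (ι × o) ℝ) = blockDiagonal (fun _ : o => S - c • (1 : Matrix ι ι ℝ)) := by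
  rw [← blockDiagonal_one, ← blockDiagonal_smul, ← blockDiagonal_sub]
  rfl

/-- `a•1 − blockDiagonal (fun _ => S) = blockDiagonal (fun _ => a•1 − S)`. [folklore] -/
private theorem blockDiagonal_smul_one_sub_const {ι o : Type} [DecidableEq ι] [DecidableEq o] (S : Matrix ι ι ℝ) (a : ℝ) :
    a • (1 : Matrix (ι × o) (ι × o) ℝ) - blockDiagonal (fun _ : o => S) = blockDiagonal (fun _ : o => a • (1 : Matrix ι ι ℝ) - S) := by
  rw [← blockDiagonal_one, ← blockDiagonal_smul, ← blockDiagonal_sub]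
  rfl

end Folklore

/-! ## §1 (L1) The lower Loewner letter: [B6] (2.157) in `PosSemidef` form -/

section Lower

variable {d L : ℕ} {M : Fin d → ℕ} [∀ μ, NeZero (M μ)]

/-- ★ **(2.157) AS A LOEWNER LETTER**: for every symmetric `Δ` with the (2.153)_T lower bound `γ ≥ 0` on `{Q₁B = 0} ∩ {tree gauge}`, `(CᵀΔC − γ•1) ⪰ 0` on the free
variables (`B6Jacobian2155Torus.sandwich_lower` BY NAME). [cite: Balaban1984PropagatorsII, (2.157) p.250] -/
theorem sandwich_sub_smul_one_posSemidef (hL : 0 < L) (hLM : ∀ i, L ∣ M i)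
    {Δ : Matrix (B4.Idx (pbox M) d) (B4.Idx (pbox M) d) ℝ} (hs : Δ.IsSymm) {γ : ℝ} (hγ : 0 ≤ γ) (hl : LowerOnConstrainedT L M Δ γ) :
    ((elimT L M)ᵀ * Δ * elimT L M - γ • (1 : Matrix ↥(freeT L M) ↥(freeT L M) ℝ)).PosSemidef :=
  posSemidef_sub_smul_one_of_le_form (B6FromB4.sandwich_isSymm (elimT L M) hs) fun w => sandwich_lower hL hLM hγ hl w

/-- ★★ **THE FLAT LOWER LETTER, UNCONDITIONAL**: `(Cᵀ Δ_k C − γ′₀•1) ⪰ 0` for the (1.66) form `Δ_k = deltaPol M n` at EVERY level `n ≥ 1` and every torus with `L ∣ M_i`,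
`γ′₀ = gamma2153 d L = (4∕π²)^{d+2}∕(12d²)·L^{−(d+1)}` — [B9] p.428 «a lower bound γ₀ > 0 independent of k … proved in [4], Lemma 2.4, for U = 1».
[cite: Balaban1984PropagatorsII, (2.157) p.250; Balaban1985BackgroundPropagators, (3.158) p.428] -/
theorem sandwich_deltaPol_sub_smul_one_posSemidef (hd : 2 ≤ d) (hL : 1 ≤ L) (hLM : ∀ i, L ∣ M i) (n : ℕ) (hn : 1 ≤ n) :
    ((elimT L M)ᵀ * deltaPol M n * elimT L M - gamma2153 d L • (1 : Matrix ↥(freeT L M) ↥(freeT L M) ℝ)).PosSemidef :=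
  sandwich_sub_smul_one_posSemidef hL hLM (deltaPol_isSymm M n) (gamma2153_pos (le_trans (by norm_num) hd) hL).le
    (lowerOnConstrainedT_of_represents M hd hL n hn hLM (represents_deltaPol M n))

end Lower

/-! ## §2 (L2) The upper Loewner letter: (1.67) upper ∘ the curl bound ∘ the Schur test for `C` -/

section Upper

variable {d : ℕ} (M : Fin d → ℕ) [∀ μ, NeZero (M μ)]

/-- ★ **THE UPPER BOUND OF THE (1.66) FORM**: `⟨B, Δ_kB⟩ ≤ 8d·(π²∕4)^{2d+4}·‖B‖²` for every level `n ≥ 1` ((1.67) upper ✓`B5Bounds167Lattice.ineq167`, then the curl bound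
✓`B6Ineq2118TwoScaleV1.d1Sq_le`; `deltaPol` represents the form, ✓`represents_deltaPol`). [cite: Balaban1984PropagatorsI, (1.67) p.29] -/
theorem form_deltaPol_le (n : ℕ) (hn : 1 ≤ n) (B : B4.Idx (pbox M) d → ℝ) :
    ∑ p, B p * (deltaPol M n *ᵥ B) p ≤ 8 * d * (Real.pi ^ 2 / 4) ^ (2 * d + 4) * ∑ p, B p ^ 2 := by
  haveI : NeZero n := ⟨by omega⟩
  rw [represents_deltaPol M n B]
  have h167 := (ineq167 n M hn (ofRealCfg M (ofBox M B))).2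
  have hcurl := B6Ineq2118TwoScaleV1.d1Sq_le M (ofRealCfg M (ofBox M B))
  have hs : ∑ i, ‖ofRealCfg M (ofBox M B) i‖ ^ 2 = ∑ p, B p ^ 2 := by
    rw [sum_box_eq M (fun p => B p ^ 2), Fintype.sum_prod_type]
    refine Finset.sum_congr rfl fun t _ => Finset.sum_congr rfl fun ν _ => ?_
    simp only [ofRealCfg, Complex.norm_real, Real.norm_eq_abs, sq_abs]
    rfl
  have hc : (0 : ℝ) ≤ (Real.pi ^ 2 / 4) ^ (2 * d + 4) := by positivity
  calc formDk n M (ofRealCfg M (ofBox M B)) ≤ (Real.pi ^ 2 / 4) ^ (2 * d + 4) * d1Sq M (ofRealCfg M (ofBox M B)) := h167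
    _ ≤ (Real.pi ^ 2 / 4) ^ (2 * d + 4) * (8 * d * ∑ i, ‖ofRealCfg M (ofBox M B) i‖ ^ 2) := mul_le_mul_of_nonneg_left hcurl hc
    _ = 8 * d * (Real.pi ^ 2 / 4) ^ (2 * d + 4) * ∑ p, B p ^ 2 := by rw [hs]; ring

variable {M} {L : ℕ}

omit [∀ μ, NeZero (M μ)] in
/-- ★ **THE SCHUR TEST FOR THE ELIMINATION `C`**: `‖CB̃‖² ≤ 2·L^d·‖B̃‖²` (column sums `≤ 2`, row sums `≤ L^d`: `B6Cov2156Torus.elimT_col`∕`elimT_row`).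
[cite: Balaban1984PropagatorsII, (2.154) p.250] -/
theorem sum_sq_elimT_mulVec_le (hL : 0 < L) (hLM : ∀ i, L ∣ M i) (w : ↥(freeT L M) → ℝ) :
    ∑ p, (elimT L M *ᵥ w) p ^ 2 ≤ 2 * (L : ℝ) ^ d * ∑ f, w f ^ 2 := by
  -- per row: (Σ_f C_{pf} w_f)² ≤ (Σ_f |C_{pf}|)·(Σ_f |C_{pf}| w_f²) ≤ L^d · Σ_f |C_{pf}| w_f²
  have hrow : ∀ p, (elimT L M *ᵥ w) p ^ 2 ≤ (L : ℝ) ^ d * ∑ f, |elimT L M p f| * w f ^ 2 := by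
    intro p
    have habs : |(elimT L M *ᵥ w) p| ≤ ∑ f, |elimT L M p f| * |w f| := by
      rw [mulVec, dotProduct]
      refine (Finset.abs_sum_le_sum_abs _ _).trans (le_of_eq ?_)
      exact Finset.sum_congr rfl fun f _ => abs_mul _ _
    have hcs : (∑ f, |elimT L M p f| * |w f|) ^ 2 ≤ (∑ f, |elimT L M p f|) * ∑ f, |elimT L M p f| * w f ^ 2 := by
      have h := Finset.sum_mul_sq_le_sq_mul_sq Finset.univ (fun f => Real.sqrt |elimT L M p f|) (fun f => Real.sqrt |elimT L M p f| * |w f|)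
      have e1 : ∀ f, Real.sqrt |elimT L M p f| * (Real.sqrt |elimT L M p f| * |w f|) = |elimT L M p f| * |w f| := fun f => by
        rw [← mul_assoc, Real.mul_self_sqrt (abs_nonneg _)]
      have e2 : ∀ f, Real.sqrt |elimT L M p f| ^ 2 = |elimT L M p f| := fun f => Real.sq_sqrt (abs_nonneg _)
      have e3 : ∀ f, (Real.sqrt |elimT L M p f| * |w f|) ^ 2 = |elimT L M p f| * w f ^ 2 := fun f => by
        rw [mul_pow, Real.sq_sqrt (abs_nonneg _), sq_abs]
      simp only [e1, e2, e3] at h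
      exact h
    have h0 : 0 ≤ ∑ f, |elimT L M p f| * w f ^ 2 := Finset.sum_nonneg fun f _ => by positivity
    calc (elimT L M *ᵥ w) p ^ 2 = |(elimT L M *ᵥ w) p| ^ 2 := (sq_abs _).symm
      _ ≤ (∑ f, |elimT L M p f| * |w f|) ^ 2 := pow_le_pow_left₀ (abs_nonneg _) habs 2
      _ ≤ (∑ f, |elimT L M p f|) * ∑ f, |elimT L M p f| * w f ^ 2 := hcs
      _ ≤ (L : ℝ) ^ d * ∑ f, |elimT L M p f| * w f ^ 2 := mul_le_mul_of_nonneg_right (elimT_row hL p) h0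
  calc ∑ p, (elimT L M *ᵥ w) p ^ 2 ≤ ∑ p, (L : ℝ) ^ d * ∑ f, |elimT L M p f| * w f ^ 2 := Finset.sum_le_sum fun p _ => hrow p
    _ = (L : ℝ) ^ d * ∑ f, (∑ p, |elimT L M p f|) * w f ^ 2 := by
        rw [← Finset.mul_sum, Finset.sum_comm]
        congr 1
        exact Finset.sum_congr rfl fun f _ => by rw [Finset.sum_mul]
    _ ≤ (L : ℝ) ^ d * ∑ f, 2 * w f ^ 2 := by
        gcongr with f _
        exact elimT_col hL hLM f
    _ = 2 * (L : ℝ) ^ d * ∑ f, w f ^ 2 := by rw [← Finset.mul_sum]; ring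

/-- ★★ **THE FLAT UPPER LETTER, UNCONDITIONAL**: `(a•1 − Cᵀ Δ_k C) ⪰ 0` with `a = 16·d·L^d·(π²∕4)^{2d+4}` for every level `n ≥ 1` and every torus with `L ∣ M_i`
([B10] p.272 L1 «γ₁ is an upper bound of the positive, bounded operator C*Δ_kC»). [cite: Balaban1985UV3, p.272 L1–2; Balaban1984PropagatorsI, (1.67) p.29] -/
theorem smul_one_sub_sandwich_deltaPol_posSemidef (hL : 1 ≤ L) (hLM : ∀ i, L ∣ M i) (n : ℕ) (hn : 1 ≤ n) :
    ((16 * d * (L : ℝ) ^ d * (Real.pi ^ 2 / 4) ^ (2 * d + 4)) • (1 : Matrix ↥(freeT L M) ↥(freeT L M) ℝ)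
      - (elimT L M)ᵀ * deltaPol M n * elimT L M).PosSemidef := by
  refine posSemidef_smul_one_sub_of_form_le (B6FromB4.sandwich_isSymm (elimT L M) (deltaPol_isSymm M n)) fun w => ?_
  have hL0 : 0 < L := hL
  have hq : w ⬝ᵥ (((elimT L M)ᵀ * deltaPol M n * elimT L M) *ᵥ w) = ∑ p, (elimT L M *ᵥ w) p * (deltaPol M n *ᵥ (elimT L M *ᵥ w)) p := by
    rw [← quad_sandwich]; rfl
  have hc : (0 : ℝ) ≤ 8 * d * (Real.pi ^ 2 / 4) ^ (2 * d + 4) := by positivity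
  rw [hq]
  calc ∑ p, (elimT L M *ᵥ w) p * (deltaPol M n *ᵥ (elimT L M *ᵥ w)) p
      ≤ 8 * d * (Real.pi ^ 2 / 4) ^ (2 * d + 4) * ∑ p, (elimT L M *ᵥ w) p ^ 2 := form_deltaPol_le M n hn _
    _ ≤ 8 * d * (Real.pi ^ 2 / 4) ^ (2 * d + 4) * (2 * (L : ℝ) ^ d * ∑ f, w f ^ 2) :=
        mul_le_mul_of_nonneg_left (sum_sq_elimT_mulVec_le hL0 hLM w) hc
    _ = 16 * d * (L : ℝ) ^ d * (Real.pi ^ 2 / 4) ^ (2 * d + 4) * ∑ f, w f ^ 2 := by ring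

end Upper

/-! ## §3 (L3) Both letters transported along the definer's reindexing and the colour tripling -/

section Transport

variable {d L : ℕ} {M : Fin d → ℕ} [∀ μ, NeZero (M μ)]

/-- ★★★ **THE `hlo`∕`hhi` LETTERS OF `logZTExtensiveAsCited_piecesAC_of_loewner` FOR `QT := reindex e e (blockDiagonal (Fin 3) (Cᵀ Δ_k C))`**: for every `d ≥ 2`, `L ≥ 1`,
level `n ≥ 1`, torus with `L ∣ M_i`, and every bijection `e : ↥(freeT L M) × Fin 3 ≃ Fin m`,
`(Q − gamma2153 d L • 1).PosSemidef ∧ (16dL^d(π²∕4)^{2d+4} • 1 − Q).PosSemidef`. [cite: Balaban1984PropagatorsII, (2.157) p.250; Balaban1985UV3, (62) p.271 + p.272 L1–2] -/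
theorem loewner_letters_reindex_blockDiagonal (hd : 2 ≤ d) (hL : 1 ≤ L) (hLM : ∀ i, L ∣ M i) (n : ℕ) (hn : 1 ≤ n) {m : ℕ}
    (e : ↥(freeT L M) × Fin 3 ≃ Fin m) :
    (Matrix.reindex e e (blockDiagonal fun _ : Fin 3 => (elimT L M)ᵀ * deltaPol M n * elimT L M) - gamma2153 d L • (1 : Matrix (Fin m) (Fin m) ℝ)).PosSemidef ∧
    ((16 * d * (L : ℝ) ^ d * (Real.pi ^ 2 / 4) ^ (2 * d + 4)) • (1 : Matrix (Fin m) (Fin m) ℝ)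
      - Matrix.reindex e e (blockDiagonal fun _ : Fin 3 => (elimT L M)ᵀ * deltaPol M n * elimT L M)).PosSemidef := by
  constructor
  · rw [← reindex_sub_smul_one, blockDiagonal_const_sub_smul_one]
    exact posSemidef_reindex e (posSemidef_blockDiagonal fun _ => sandwich_deltaPol_sub_smul_one_posSemidef hd hL hLM n hn)
  · rw [← reindex_smul_one_sub, blockDiagonal_smul_one_sub_const]
    exact posSemidef_reindex e (posSemidef_blockDiagonal fun _ => smul_one_sub_sandwich_deltaPol_posSemidef hL hLM n hn)

/-- The same WITHOUT the colour tripling (one real component; any `e : ↥(freeT L M) ≃ Fin m`). [cite: Balaban1984PropagatorsII, (2.157) p.250] -/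
theorem loewner_letters_reindex (hd : 2 ≤ d) (hL : 1 ≤ L) (hLM : ∀ i, L ∣ M i) (n : ℕ) (hn : 1 ≤ n) {m : ℕ} (e : ↥(freeT L M) ≃ Fin m) :
    (Matrix.reindex e e ((elimT L M)ᵀ * deltaPol M n * elimT L M) - gamma2153 d L • (1 : Matrix (Fin m) (Fin m) ℝ)).PosSemidef ∧
    ((16 * d * (L : ℝ) ^ d * (Real.pi ^ 2 / 4) ^ (2 * d + 4)) • (1 : Matrix (Fin m) (Fin m) ℝ)
      - Matrix.reindex e e ((elimT L M)ᵀ * deltaPol M n * elimT L M)).PosSemidef := by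
  constructor
  · rw [← reindex_sub_smul_one]
    exact posSemidef_reindex e (sandwich_deltaPol_sub_smul_one_posSemidef hd hL hLM n hn)
  · rw [← reindex_smul_one_sub]
    exact posSemidef_reindex e (smul_one_sub_sandwich_deltaPol_posSemidef hL hLM n hn)

end Transport

end Summit.QuantumFields.YangMills.Theorems.AlphaInputsT3ACFlatLoewnerLetters

end
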